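import Summits.ResolutionOfSingularities.ResolutionOfSingularities.Theorems.LossPolygon
import Summits.ResolutionOfSingularities.ResolutionOfSingularities.Theorems.LossExitCone3
import HarnessLib

/-!
# LossEntryW25 — decomp-res lens-3 g29 «LossEntryWalk», landing part 25 (slice 17): the WALL-STATE PENCIL LAW

Residual `stmt-ResolutionOfSingularities-27367` (`WallCut.NoLossyStrictTailsDeep` ⟸ `LossEpisode.LawLossEntry` ⟸
`LossEpisode.LawLossChain`).  This part is INDEPENDENT of parts 12–24 (imports tree files only) and supplies the one
algebraic law the chain assembly (NODE-g29 §3ter (AL′)) was missing: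

* `resForm_eq_pure_of_wall_pure` — at a one-wall state `u` (boundary `M·e_a`, shade `s`, order `s+M > q`) moving in a
  chart `b ≠ a` with a shade plateau and LEAVING the wall (`b_u(a) ≠ 0`), if the IN-WALL slice of the lowest layer is
  the pure power `φ₀·(u_c − μ u_b)^s` then the residual form of the move (`ConeCut.resForm`) is the pure power
  `C φ₀ · (u_c − κ u_a)^s`, `κ = (b_u(c) − μ)/b_u(a)`: the lowest layer of `F_u` is `φ₀·u_a^M·(u_c − μ u_b − κ u_a)^s`,
  the pencil line through the direction of the move;
* `wall_pure_succ` — consequently (pencil transport = `ConeCut.restriction_of_plateau`) the in-wall slice of the NEXT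
  state (new wall `u_b`) is pure with root `κ`: purity of the in-wall slice PROPAGATES FORWARD along a one-wall tail.

Engine: `ConeCut.cone_of_plateau` (the translated `u_b`-dehomogenised lowest layer is a FORM of degree `s`) and a
binary-form coefficient comparison (`eq_zero_of_translate_axis`: a form in `u_a,u_c` whose translate by `g`, `g_a ≠ 0`,
has no pure `u_c`-powers is zero).  Tree tools only; complete proofs, standard axioms.

(Sources: Hauser2010 §F; HauserPerlega2019 §2; CossartJannsenSaito2020 Ch. 8; Moh1987; Perlega2022.)
-/

open MvPolynomial Finset
open Literature.AlgebraicGeometry.Resolution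
open Literature.AlgebraicGeometry.Resolution.Hauser2010
open Literature.AlgebraicGeometry.Resolution.PointBlowup
open Summit.ResolutionOfSingularities.ResolutionOfSingularities.Theorems.TightDefectClasses
open Summit.ResolutionOfSingularities.ResolutionOfSingularities.Theorems.TightDefectStrongWalks
open Summit.ResolutionOfSingularities.ResolutionOfSingularities.Theorems.ItineraryCutClasses
open Summit.ResolutionOfSingularities.ResolutionOfSingularities.Theorems.BoundaryLedger
open Summit.ResolutionOfSingularities.ResolutionOfSingularities.Theorems.ProximityCut
open Summit.ResolutionOfSingularities.ResolutionOfSingularities.Theorems.ConeCut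
open Summit.ResolutionOfSingularities.ResolutionOfSingularities.Theorems.LossExitCone

namespace Summit.ResolutionOfSingularities.ResolutionOfSingularities.Theorems.LossPolygon

section WallStatePencilLaw

variable {K : Type} [Field K] [DecidableEq K] {q : ℕ} {s₀ : State (Fin 3) K}

omit [DecidableEq K] in
/-- Product over `Fin 3` written in three pairwise distinct letters. [folklore] -/
theorem prod_univ_fin3 {a b c : Fin 3} (hab : a ≠ b) (hac : a ≠ c) (hbc : b ≠ c) (f : Fin 3 → K) :
    ∏ i, f i = f a * f b * f c := by
  have huniv : (Finset.univ : Finset (Fin 3)) = {a, b, c} := by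
    ext w
    simp only [Finset.mem_univ, Finset.mem_insert, Finset.mem_singleton, true_iff]
    exact fin3_eq_or a b c w hab hac hbc
  rw [huniv, Finset.prod_insert (by simp [hab, hac]), Finset.prod_insert (by simp [hbc]), Finset.prod_singleton,
    mul_assoc]

omit [DecidableEq K] in
/-- **Binary forms are determined by an axis of a generic translate (PROVED).**  A form `D` of degree `s` in
`u_a, u_c` (no `u_b`) whose translate by `g`, `g_a ≠ 0`, has no pure power `u_c^i` (`i ≤ s`) among its monomials is
zero: the top `u_c`-power of `D` survives in the translate with the coefficient `coeff · g_a^{E a} ≠ 0`. [folklore] -/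
theorem eq_zero_of_translate_axis {a b c : Fin 3} (hab : a ≠ b) (hac : a ≠ c) (hbc : b ≠ c)
    {D : MvPolynomial (Fin 3) K} {s : ℕ} (hD : D.IsHomogeneous s) (hDb : ∀ E ∈ D.support, E b = 0)
    (g : Fin 3 → K) (hga : g a ≠ 0)
    (hax : ∀ i : ℕ, i ≤ s → coeff (Finsupp.single c i) (translate g D) = 0) : D = 0 := by
  classical
  by_contra hne
  have hsupp : D.support.Nonempty := by
    rw [Finset.nonempty_iff_ne_empty, Ne, MvPolynomial.support_eq_empty]
    exact hne
  have himg : (D.support.image fun E : Fin 3 →₀ ℕ => E c).Nonempty := hsupp.image _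
  obtain ⟨E₀, hE₀, hE₀c⟩ := Finset.mem_image.mp (Finset.max'_mem _ himg)
  have hmax : ∀ E ∈ D.support, E c ≤ E₀ c := fun E hE => by
    rw [hE₀c]
    exact Finset.le_max' _ _ (Finset.mem_image_of_mem (fun E : Fin 3 →₀ ℕ => E c) hE)
  have hdegE : ∀ E ∈ D.support, E a + E c = s := by
    intro E hE
    have h1 : E.degree = s := by
      by_contra h
      exact (MvPolynomial.mem_support_iff.mp hE) (hD.coeff_eq_zero h)
    rw [degree_fin3 hab hac hbc E, hDb E hE, add_zero] at h1
    exact h1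
  have hi₀s : E₀ c ≤ s := by have := hdegE E₀ hE₀; omega
  have hkey : coeff (Finsupp.single c (E₀ c)) (translate g D) = coeff E₀ D * g a ^ (E₀ a) := by
    conv_lhs => rw [D.as_sum, translate_finset_sum, coeff_sum]
    rw [Finset.sum_eq_single E₀]
    · rw [WeightedBlowup.coeff_translate_monomial, prod_univ_fin3 hab hac hbc,
        Finsupp.single_eq_of_ne hac, Finsupp.single_eq_of_ne hbc, Finsupp.single_eq_same, hDb E₀ hE₀]
      simp
    · intro E hE hne'
      rw [WeightedBlowup.coeff_translate_monomial, prod_univ_fin3 hab hac hbc, Finsupp.single_eq_same]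
      rcases (hmax E hE).lt_or_eq with hlt | heq
      · rw [Nat.choose_eq_zero_of_lt hlt, Nat.cast_zero, zero_mul, mul_zero, mul_zero]
      · exfalso
        apply hne'
        rw [finsupp_fin3_eq hab hac hbc E, finsupp_fin3_eq hab hac hbc E₀, heq, hDb E hE, hDb E₀ hE₀]
        have hEa : E a = E₀ a := by have h1 := hdegE E hE; have h2 := hdegE E₀ hE₀; omega
        rw [hEa]
    · intro h
      exact absurd hE₀ h
  have h0 := hax (E₀ c) hi₀s
  rw [hkey] at h0
  exact (mul_ne_zero (MvPolynomial.mem_support_iff.mp hE₀) (pow_ne_zero _ hga)) h0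

omit [DecidableEq K] in
/-- The variable `u_b` does not occur in `(u_c − κ u_a)^n`. [folklore] -/
theorem coeff_pure_pow_eq_zero {a b c : Fin 3} (hab : a ≠ b) (hbc : b ≠ c) (κ : K) :
    ∀ (n : ℕ) (E : Fin 3 →₀ ℕ), E b ≠ 0 → coeff E ((X c - C κ * X a) ^ n : MvPolynomial (Fin 3) K) = 0 := by
  classical
  intro n
  induction n with
  | zero =>
    intro E hEb
    rw [pow_zero, coeff_one, if_neg]
    intro h0
    apply hEb
    rw [← h0, Finsupp.zero_apply]
  | succ n ih =>
    intro E hEb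
    have hsub : ∀ l : Fin 3, l ≠ b → (E - Finsupp.single l 1 : Fin 3 →₀ ℕ) b ≠ 0 := by
      intro l hlb
      rw [Finsupp.tsub_apply, Finsupp.single_eq_of_ne (Ne.symm hlb), Nat.sub_zero]
      exact hEb
    rw [pow_succ, mul_sub, coeff_sub, coeff_mul_X', mul_left_comm, coeff_C_mul, coeff_mul_X']
    have h1 : (if c ∈ E.support then coeff (E - Finsupp.single c 1) ((X c - C κ * X a) ^ n) else 0) = 0 := by
      split_ifs
      · exact ih _ (hsub c (Ne.symm hbc))
      · rfl
    have h2 : κ * (if a ∈ E.support then coeff (E - Finsupp.single a 1) ((X c - C κ * X a) ^ n) else 0) = 0 := by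
      split_ifs
      · rw [ih _ (hsub a hab), mul_zero]
      · rw [mul_zero]
    rw [h1, h2, sub_zero]

omit [DecidableEq K] in
/-- The variable `u_b` does not occur in `C φ₀ · (u_c − κ u_a)^n`. [folklore] -/
theorem apply_eq_zero_of_mem_support_pure {a b c : Fin 3} (hab : a ≠ b) (hbc : b ≠ c) (φ₀ κ : K) (n : ℕ)
    (E : Fin 3 →₀ ℕ) (hE : E ∈ (C φ₀ * (X c - C κ * X a) ^ n : MvPolynomial (Fin 3) K).support) : E b = 0 := by
  by_contra hEb
  apply MvPolynomial.mem_support_iff.mp hE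
  rw [coeff_C_mul, coeff_pure_pow_eq_zero hab hbc κ n E hEb, mul_zero]

omit [DecidableEq K] in
/-- The `u_a`-free coefficients of `(P − u_a·C κ)^n` are those of `P^n`. [folklore] -/
theorem coeff_single_pow_sub_X_mul {a c : Fin 3} (hac : a ≠ c) (P : MvPolynomial (Fin 3) K) (κ : K) (n i : ℕ) :
    coeff (Finsupp.single c i) ((P - X a * C κ) ^ n) = coeff (Finsupp.single c i) (P ^ n) := by
  classical
  obtain ⟨T, hT⟩ := sub_dvd_pow_sub_pow P (P - X a * C κ) n
  rw [sub_sub_cancel] at hT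
  have h : P ^ n = (P - X a * C κ) ^ n + X a * (C κ * T) := by rw [← mul_assoc, ← hT]; ring
  rw [h, coeff_add, coeff_X_mul', if_neg, add_zero]
  rw [Finsupp.mem_support_iff, Finsupp.single_eq_of_ne hac]
  exact fun h => h rfl

/-- **WALL-STATE PENCIL LAW — residual form (PROVED).**  At a one-wall state `u` (boundary `M·e_a`, shade `s`,
order `s + M > q`) moving in the chart `b ≠ a` with a shade plateau and LEAVING the wall (`b_u(a) ≠ 0`): if the
in-wall slice of the lowest layer is pure, `coeff_{r+E} F_u = φ₀·coeff_E (u_c − μ u_b)^s` for `|E| = s`, `E a = 0`,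
then the residual form of the move is the pure power `C φ₀ · (u_c − κ u_a)^s`, `κ = (b_u(c) − μ)/b_u(a)` — the lowest
layer of `F_u` is `φ₀·u_a^M·(u_c − μ u_b − κ u_a)^s`, the pencil line through the direction of the move.
Tree tools only: `cone_of_plateau`, `coeff_resLayer`, `coeff_update_linear_pow`, `eq_zero_of_translate_axis`.
[new] [folklore] -/
theorem resForm_eq_pure_of_wall_pure (hroot : IsRoot q s₀) (W : ForcedWalk q s₀) (u : ℕ) {a b c : Fin 3}
    (hab : a ≠ b) (hac : a ≠ c) (hbc : b ≠ c) (hj : W.j u = b) {M s : ℕ}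
    (hr : (W.st u).r = Finsupp.single a M) (hsh : (W.st u).shade = (s : ℕ∞))
    (hplat : (W.st (u + 1)).shade = (W.st u).shade) (hq : q < s + M) (hga : W.b u a ≠ 0) {φ₀ μ : K}
    (hwall : ∀ E : Fin 3 →₀ ℕ, E.degree = s → E a = 0 →
      coeff ((W.st u).r + E) (W.st u).F = φ₀ * coeff E ((X c - C μ * X b) ^ s)) :
    ordZero (W.st u).F = ((s + M : ℕ) : ℕ∞) ∧
      resForm W u (s + M) = C φ₀ * (X c - C ((W.b u c - μ) / W.b u a) * X a) ^ s := by
  classical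
  obtain ⟨o, ho, -⟩ := walk_nat hroot W u
  obtain ⟨n, hn, hon⟩ := order_eq_shade_add_degree hroot W u ho
  have hns : n = s := by
    have h := hsh
    rw [hn] at h
    exact_mod_cast h
  subst hns
  have hrdeg : (W.st u).r.degree = M := by rw [hr, Finsupp.degree_single]
  rw [hrdeg] at hon
  subst hon
  refine ⟨ho, ?_⟩
  have hqo : q < n + M := hq
  have hcone := (cone_of_plateau hroot W u ho hqo hplat hn).1
  set κ : K := (W.b u c - μ) / W.b u a with hκ
  have hκμ : W.b u c - κ * W.b u a = μ := by
    rw [hκ, div_mul_cancel₀ _ hga]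
    ring
  set Q : MvPolynomial (Fin 3) K := C φ₀ * (X c - C κ * X a) ^ n with hQ
  have hQhom : Q.IsHomogeneous n := by
    have h1 : (X c - C κ * X a : MvPolynomial (Fin 3) K).IsHomogeneous 1 :=
      (isHomogeneous_X K c).sub (by simpa using (isHomogeneous_C (Fin 3) κ).mul (isHomogeneous_X K a))
    simpa [hQ] using (isHomogeneous_C (Fin 3) φ₀).mul (h1.pow n)
  have hDhom : (resForm W u (n + M) - Q).IsHomogeneous n := hcone.sub hQhom
  have hDb : ∀ E ∈ (resForm W u (n + M) - Q).support, E b = 0 := by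
    intro E hE
    by_contra hEb
    apply MvPolynomial.mem_support_iff.mp hE
    rw [coeff_sub, coeff_resForm_eq_zero W u _ (by rw [hj]; exact hEb), zero_sub, neg_eq_zero]
    by_contra hQE
    exact hEb (apply_eq_zero_of_mem_support_pure hab hbc φ₀ κ n E (MvPolynomial.mem_support_iff.mpr hQE))
  -- the `u_a`-free coefficients of the UNtranslated difference vanish
  have hax : ∀ i : ℕ, i ≤ n →
      coeff (Finsupp.single c i) (translate (-W.b u) (resForm W u (n + M) - Q)) = 0 := by
    intro i hi
    have hL : translate (-W.b u) (resForm W u (n + M)) = resLayer (W.j u) (W.st u) (n + M) := by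
      unfold resForm
      rw [LossExitCone.translate_translate, neg_add_cancel, PointBlowup.translate_zero]
    have hQ' : translate (-W.b u) Q = C φ₀ * ((X c - C μ) - X a * C κ) ^ n := by
      rw [hQ, translate_C_mul_pow, translate_linear, Pi.neg_apply, Pi.neg_apply, ← hκμ]
      congr 2
      simp only [C_sub, C_mul, C_neg]
      ring
    set m : Fin 3 →₀ ℕ := Finsupp.single c i + Finsupp.single b (n - i) with hm
    have hmdeg : m.degree = n := by
      rw [hm, map_add, Finsupp.degree_single, Finsupp.degree_single]
      omega
    have hma : m a = 0 := by
      rw [hm, Finsupp.add_apply, Finsupp.single_eq_of_ne hac, Finsupp.single_eq_of_ne hab, add_zero]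
    have hupd : m.update b 0 = Finsupp.single c i := by
      ext w
      rw [Finsupp.update_apply]
      by_cases hwb : w = b
      · rw [if_pos hwb, hwb, Finsupp.single_eq_of_ne hbc]
      · rw [if_neg hwb, hm, Finsupp.add_apply, Finsupp.single_eq_of_ne (a := b) hwb, add_zero]
    rw [translate_sub, coeff_sub, hL, hQ', ← hupd, ← hj, coeff_resLayer (W.j u) (W.st u) (walk_r hroot W u)
      (n + M) m (by rw [hmdeg, hrdeg]), hwall m hmdeg hma, hj, hupd, coeff_C_mul,
      coeff_single_pow_sub_X_mul hac, ← coeff_update_linear_pow hbc.symm μ hmdeg, hupd, sub_self]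
  have hD0 := eq_zero_of_translate_axis hab hac hbc hDhom hDb (-W.b u) (by rw [Pi.neg_apply, neg_ne_zero]; exact hga)
    hax
  rwa [sub_eq_zero] at hD0

/-- **WALL-STATE PENCIL LAW — the next in-wall slice (PROVED; pencil transport = `restriction_of_plateau`).**
Under the hypotheses of `resForm_eq_pure_of_wall_pure`, the `u_b`-free face of the next state's lowest layer (the
in-wall slice of the NEW wall `u_b`) is pure with the new root `κ = (b_u(c) − μ)/b_u(a)`:
`coeff_{r_{u+1}+m} F_{u+1} = U_u(0)·φ₀ · coeff_m (u_c − κ u_a)^s` for `|m| = s`, `m b = 0`. [new] [folklore] -/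
theorem wall_pure_succ (hroot : IsRoot q s₀) (W : ForcedWalk q s₀) (u : ℕ) {a b c : Fin 3}
    (hab : a ≠ b) (hac : a ≠ c) (hbc : b ≠ c) (hj : W.j u = b) {M s : ℕ}
    (hr : (W.st u).r = Finsupp.single a M) (hsh : (W.st u).shade = (s : ℕ∞))
    (hplat : (W.st (u + 1)).shade = (W.st u).shade) (hq : q < s + M) (hga : W.b u a ≠ 0) {φ₀ μ : K}
    (hwall : ∀ E : Fin 3 →₀ ℕ, E.degree = s → E a = 0 →
      coeff ((W.st u).r + E) (W.st u).F = φ₀ * coeff E ((X c - C μ * X b) ^ s))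
    (m : Fin 3 →₀ ℕ) (hmb : m b = 0) (hm : m.degree = s) :
    coeff ((W.st (u + 1)).r + m) (W.st (u + 1)).F =
      (bUnit W u * φ₀) * coeff m ((X c - C ((W.b u c - μ) / W.b u a) * X a) ^ s) := by
  obtain ⟨ho, hres⟩ := resForm_eq_pure_of_wall_pure hroot W u hab hac hbc hj hr hsh hplat hq hga hwall
  rw [restriction_of_plateau hroot W u ho (by exact_mod_cast hq) hplat hsh m (by rw [hj]; exact hmb) hm, hres,
    coeff_C_mul, mul_assoc]

end WallStatePencilLaw

end Summit.ResolutionOfSingularities.ResolutionOfSingularities.Theorems.LossPolygon
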